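/-
COR-CM (cell pub-hodgecm2, stage 2 of the Hodge ladder) — junction B01, leaf B01-O `Universe.FaceWedgeOverlap` and the coupling
clause (α) of the END-DISPLAY binder `hD`: the REDUCTION OF SATURATED (α) TO PER-PAIR SETTINGS + EXHAUSTION (own-b01 g2 OWNER LINE,
HOME/INBOX l.4212 «x2 — RE-POINTED … `CorCM/B01/FaceWedgeOverlapOfExhaustion.lean`», refined l.4306; lead NAMING RULING l.4194 (3):
writer of `CorCM/B01/FaceWedgeOverlap*.lean` = pub-hodgecm2-b01-x2).  KERNEL CONTENT AUTHORED by the B01 ideation lens-1 seat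
planner-pub-hodgecm2-b01-idea-1-g18-0 (`HOME/b01/IDEA-1r-Sketch.lean` md5 b67733a9fc90, farm rc 0, 2026-08-21T16:48Z; memo
`HOME/b01/IDEA-1r-per-pair-settings.md` 992b1d1adeda) with the closure-algebra reading of lens 2 (planner-pub-hodgecm2-b01-idea-2-g18-0,
`HOME/b01/IDEA-2s-saturated-coupling.md` §0 V1, TRAP T1); FILED (this header, namespace, the `iff`/hD-shape corollaries) by
prover-pub-hodgecm2-b01-x2-0 (gen 1), 2026-08-21.  Theorems only: no `def`, no cite binder, no `_holds`, nothing asserted, no `sorry`.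
FRAMING (COORDINATOR RULING 2026-08-21T11:55:35Z): HC_CM is NOT proved; B01-O / `hD` are NOT proved; this file REDUCES clause (α).
-/
import Summits.HodgeConjecture.CorCM.B01.Transposition.Item5IsolationSpansHolds
import HarnessLib

/-!
# Saturated coupling (α) ⇐ per-pair isolation settings + EXHAUSTION + (34)-typing — the kernel statement of the gap between `hD` and PerL

The END DISPLAY of record `Model.hc_cm_of_supply_of_dictionary_of_eq` (`Transposition/Item6HoldsRec.lean`:205–230) carries the
binder `hD` whose clause (α) is item (v)'s coupling at the SATURATED theta sets `Θ i Γ := U_{ψ i}(Γ)_{ι₁}` (`Universe.Uiso`): EVERY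
(12)-wedge-function of `U_{ψ₀}`/`U_{ψ₁}`-classes lies in the closed span of ALL (34)-wedge-functions of `U_{ψ₂}`/`U_{ψ₃}`-classes over
all levels.  By `IsolationSpans.uiso_iff` below this is `Transposition.IsolationSpans U emb (fun i Γ => ↑(U.Uiso Γ F (f.psi i) ι₁))`
ON THE NOSE.  The tree discharges `IsolationSpans` only PER ISOLATION SETTING — `IsolationSpans.ofSetting (S) (hg : Gen12 …) (hr)`
(`Item5IsolationSpansHolds.lean`:184; PerL Prop 3.6 / Thm 3.7 are tree theorems for EVERY abstract setting, p277743) — i.e. for the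
theta sets of ONE seesaw plane `W = W_a ⊞ W_b ≅ W_c ⊞ W_d`, whereas arbitrary `U_ψ`-classes are combinations of theta lifts from MANY
hermitian lines (own-b01 (O-J), l.4212).  THIS FILE is the universe-generic reduction the owner asked for:

  saturated (α)  ⇐  (E1) EXHAUSTION  `U.Uiso Γ F (f.psi i) ι₁ ≤ span (⋃ₐ Θᵢ a Γ)` for `i = 0, 1` (line-theta families `Θ₀ a`, `Θ₁ b`)
                 +  (E2) PER PAIR `(a, b)`: a pair family `Θp a b` containing `Θ₀ a`, `Θ₁ b` in its (12) slots, an isolation setting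
                    `S a b : Perl34.IsolationSetting …` (pair-dependent carriers; only `HG` common) and its two Lemma-3.5 memberships
                    `hg : Gen12 U emb (Θp a b) (Datum.ofSetting (S a b))`, `hr` (Real34, generator form) — PerL §3 VERBATIM per plane;
                 +  (E3) (34)-TYPING `Θp a b 2 Γ ⊆ U_{ψ₂}(Γ)`, `Θp a b 3 Γ ⊆ U_{ψ₃}(Γ)` (`Theta_sub` on slots 2, 3: the identification
                    rows of S2 read on the (34) side — NOT their non-vanishing).
The proof is `Submodule.span`/`topologicalClosure` algebra only (bilinearity of `U.cup2C _ 1`, linearity of `emb Γ`, the closed span is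
a submodule; pick the lines of the two given forms, apply that pair's coupling, enlarge the (34) span).  TRAP T1 (idea-2 §0) is
respected: the (34) side keeps `topologicalClosure` over ALL levels and ALL classes — no bounded-level / fixed-character truncation
(which would convert PerL's density argument into Waldspurger's criterion and central `L`-values).

RESIDUAL BINDERS OF SATURATED (α), BY NAME (what stands between `hD`'s coupling clause and print; nothing here is typed as a cite):
* (E1) EXHAUSTION `hE0`, `hE1` — «every `A_ψ`-isotypic `σ`-eigen holomorphic one-form on `P_Γ` is a finite combination of torus theta
  lifts from hermitian lines»: in print J. Rogawski, *Automorphic Representations of Unitary Groups in Three Variables* (Ann. of Math.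
  Stud. 123, 1990) §13.3 (Thms 13.3.1, 13.3.6–7) with [GR91] S. Gelbart–J. Rogawski, Invent. Math. 105 (1991) §3, and [Liu 2021]
  Prop. 4.13 / Rem. 4.14 / Thm 4.18 (2) (arXiv:2102.11518) — the ONE non-PerL input; the only slots that need it are 0 and 1.
* (E2) one `IsolationSetting` INSTANCE per pair of allowed lines + `Gen12` + `hr` — PerL Lemma 3.4 / 3.5 / Prop 3.6 / Thm 3.7 re-run
  per plane (stage 1 instantiates ONE plane; the construction is plane-uniform: idea-2 §0 V1 (i)–(iii), idea-1 memo §C); open at a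
  face = the (v-S) setting instance of the B01-O STATE line (own-b01 l.4246).
* (E3) `Theta_sub` for slots 2, 3 of every pair family.
NOT supplied here (asked «if cheap», l.4212): a converse `FaceWedgeOverlap → (α)`; it is not cheap and not valid abstractly — B01-O's
`heckeSpan` runs over ALL morphisms `P_{Γ'} → P_Γ` while the dictionary relates `L²`-images only along `cover`s (`emb_cover`); see
`CorCM/B01/FaceWedgeOverlapDescent.lean` (p290964: B01-O ⇐ `hD` ∧ LEVEL DESCENT) and `CorCM/B01/FaceWedgeOverlapBypass.lean` (p291484:
B01 ⇐ B01-S ∧ `hD`, B01-O bypassed) for the two directions that do hold.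

## Contents (namespace `Summit.HodgeConjecture.CorCM.Transposition.IsolationSpans`)
§1 `thetaWedgeFns_mono`, `closedSpan_thetaWedgeFns_mono`, `of_subset` (antitone in slots 0,1 / monotone in slots 2,3) ·
§2 `of_span` (SPAN STEP) · §3 `of_pairFamilies`, `of_pairFamilies_span`, `of_pairSettings` (PER-PAIR STEP, the last over
`IsolationSpans.ofSetting`) · §4 `uiso_iff` (clause (α) of `hD` IS `IsolationSpans` at the `Uiso` family, `Iff.rfl`),
`saturated_of_pairSettings` (THE REDUCTION), `coupling_uiso_of_pairSettings` (the same, printed in `hD`'s literal clause shape).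
HC_CM is NOT proved; nothing here is inhabited.
-/

noncomputable section

open scoped TensorProduct InnerProductSpace

namespace Summit.HodgeConjecture.CorCM

open Literature.AlgebraicGeometry.Motives (CMType HodgeStructure)
open Prior.Perl34File (Perl34.IsolationSetting)
open Prior.Perl34File.Perl34

namespace Transposition

namespace IsolationSpans

variable {U : Universe} {L : CMField} {ι₁ : L →+* ℂ} {V : HermSpace3 L ι₁}
  {HG : Type*} [NormedAddCommGroup HG] [InnerProductSpace ℂ HG]
  {emb : ∀ Γ : Level V, U.CohC (U.pms L ι₁ V Γ) 2 →ₗ[ℂ] HG}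
  {Θ Θ' : Fin 4 → ∀ Γ : Level V, Set (U.CohC (U.pms L ι₁ V Γ) 1)}

/-! ## §1  Monotonicity of the generating sets and of `IsolationSpans` -/

/-- The theta `(ij)`-wedge-function set grows with the slots `i`, `j`. [folklore] -/
theorem thetaWedgeFns_mono {i j : Fin 4} (hi : ∀ Γ, Θ i Γ ⊆ Θ' i Γ) (hj : ∀ Γ, Θ j Γ ⊆ Θ' j Γ) :
    thetaWedgeFns U emb Θ i j ⊆ thetaWedgeFns U emb Θ' i j := by
  rintro x ⟨Γ, ω, hω, ω', hω', rfl⟩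
  exact ⟨Γ, ω, hi Γ hω, ω', hj Γ hω', rfl⟩

/-- … hence so does its closed span. [folklore] -/
theorem closedSpan_thetaWedgeFns_mono {i j : Fin 4} (hi : ∀ Γ, Θ i Γ ⊆ Θ' i Γ) (hj : ∀ Γ, Θ j Γ ⊆ Θ' j Γ) :
    (Submodule.span ℂ (thetaWedgeFns U emb Θ i j)).topologicalClosure ≤
      (Submodule.span ℂ (thetaWedgeFns U emb Θ' i j)).topologicalClosure :=
  Submodule.topologicalClosure_mono (Submodule.span_mono (thetaWedgeFns_mono hi hj))

/-- `IsolationSpans` is ANTITONE in the (12) slots and MONOTONE in the (34) slots. [folklore] -/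
theorem of_subset (h : IsolationSpans U emb Θ)
    (h0 : ∀ Γ, Θ' 0 Γ ⊆ Θ 0 Γ) (h1 : ∀ Γ, Θ' 1 Γ ⊆ Θ 1 Γ)
    (h2 : ∀ Γ, Θ 2 Γ ⊆ Θ' 2 Γ) (h3 : ∀ Γ, Θ 3 Γ ⊆ Θ' 3 Γ) :
    IsolationSpans U emb Θ' := fun Γ ω₁ ω₂ hω₁ hω₂ =>
  closedSpan_thetaWedgeFns_mono h2 h3 (h Γ ω₁ ω₂ (h0 Γ hω₁) (h1 Γ hω₂))

/-! ## §2  The span step (saturation in the (12) slots) -/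

/-- **Span step.**  If every theta (12)-wedge-function of `Θ` is coupled, so is every (12)-wedge-function of classes in the linear
SPANS of `Θ 0 Γ`, `Θ 1 Γ` (and the (34) slots may be enlarged): `U.cup2C _ 1` is bilinear, `emb Γ` is linear, the closed span of the
(34)-wedge-functions is a submodule.  This is the «per-family (α) ⇒ saturated (α)» half of own-b01's (O-J), given exhaustion as a SET
inclusion into a span. [folklore] -/
theorem of_span (h : IsolationSpans U emb Θ)
    (h0 : ∀ Γ, Θ' 0 Γ ⊆ (Submodule.span ℂ (Θ 0 Γ) : Set (U.CohC (U.pms L ι₁ V Γ) 1)))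
    (h1 : ∀ Γ, Θ' 1 Γ ⊆ (Submodule.span ℂ (Θ 1 Γ) : Set (U.CohC (U.pms L ι₁ V Γ) 1)))
    (h2 : ∀ Γ, Θ 2 Γ ⊆ Θ' 2 Γ) (h3 : ∀ Γ, Θ 3 Γ ⊆ Θ' 3 Γ) :
    IsolationSpans U emb Θ' := by
  intro Γ ω₁ ω₂ hω₁ hω₂
  refine closedSpan_thetaWedgeFns_mono h2 h3 ?_
  have step1 : ∀ ω₂' ∈ Θ 1 Γ, ∀ ω₁' ∈ Submodule.span ℂ (Θ 0 Γ),
      emb Γ (U.cup2C (U.pms L ι₁ V Γ) 1 ω₁' ω₂') ∈ (Submodule.span ℂ (thetaWedgeFns U emb Θ 2 3)).topologicalClosure := by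
    intro ω₂' hω₂' ω₁' hω₁'
    have hle : Submodule.span ℂ (Θ 0 Γ) ≤ ((Submodule.span ℂ (thetaWedgeFns U emb Θ 2 3)).topologicalClosure).comap
        ((emb Γ).comp ((U.cup2C (U.pms L ι₁ V Γ) 1).flip ω₂')) :=
      Submodule.span_le.2 fun η hη => h Γ η ω₂' hη hω₂'
    exact hle hω₁'
  have step2 : ∀ ω₁' ∈ Submodule.span ℂ (Θ 0 Γ), ∀ ω₂' ∈ Submodule.span ℂ (Θ 1 Γ),
      emb Γ (U.cup2C (U.pms L ι₁ V Γ) 1 ω₁' ω₂') ∈ (Submodule.span ℂ (thetaWedgeFns U emb Θ 2 3)).topologicalClosure := by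
    intro ω₁' hω₁' ω₂' hω₂'
    have hle : Submodule.span ℂ (Θ 1 Γ) ≤ ((Submodule.span ℂ (thetaWedgeFns U emb Θ 2 3)).topologicalClosure).comap
        ((emb Γ).comp (U.cup2C (U.pms L ι₁ V Γ) 1 ω₁')) :=
      Submodule.span_le.2 fun η hη => step1 η hη ω₁' hω₁'
    exact hle hω₂'
  exact step2 ω₁ (h0 Γ hω₁) ω₂ (h1 Γ hω₂)

/-! ## §3  The per-pair (union) step -/

/-- **Per-pair step.**  `Θ`'s (12) slots are covered by sub-families `Θ₀ a` (`a : A`), `Θ₁ b` (`b : B`) — in the model: the theta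
one-forms FROM ONE ALLOWED HERMITIAN LINE `W_a` of type `ψ₀` (all characters, all Fock–Schwartz vectors), resp. `W_b` of type `ψ₁` —,
and for every pair `(a, b)` there is a pair family `Θp a b` (in the model: the four theta sets of PerL's seesaw for the plane
`W_a ⊞ W_b ≅ W_c ⊞ W_d`, Landherr) containing `Θ₀ a`, `Θ₁ b` in its (12) slots and contained in `Θ` in its (34) slots, for which
`IsolationSpans` holds (PerL Thm 3.7 + Lemma 3.5 AT THAT SETTING: `IsolationSpans.ofSetting`).  Then `IsolationSpans` holds for `Θ`.
Proof: pick the lines of the two given forms, apply the pair's coupling, enlarge the (34) span. [folklore] -/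
theorem of_pairFamilies {A B : Type*}
    (Θ₀ : A → ∀ Γ : Level V, Set (U.CohC (U.pms L ι₁ V Γ) 1))
    (Θ₁ : B → ∀ Γ : Level V, Set (U.CohC (U.pms L ι₁ V Γ) 1))
    (Θp : A → B → Fin 4 → ∀ Γ : Level V, Set (U.CohC (U.pms L ι₁ V Γ) 1))
    (h0 : ∀ a b Γ, Θ₀ a Γ ⊆ Θp a b 0 Γ) (h1 : ∀ a b Γ, Θ₁ b Γ ⊆ Θp a b 1 Γ)
    (h2 : ∀ a b Γ, Θp a b 2 Γ ⊆ Θ 2 Γ) (h3 : ∀ a b Γ, Θp a b 3 Γ ⊆ Θ 3 Γ)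
    (hcov0 : ∀ Γ, Θ 0 Γ ⊆ ⋃ a, Θ₀ a Γ) (hcov1 : ∀ Γ, Θ 1 Γ ⊆ ⋃ b, Θ₁ b Γ)
    (hpair : ∀ a b, IsolationSpans U emb (Θp a b)) :
    IsolationSpans U emb Θ := by
  intro Γ ω₁ ω₂ hω₁ hω₂
  obtain ⟨a, ha⟩ := Set.mem_iUnion.1 (hcov0 Γ hω₁)
  obtain ⟨b, hb⟩ := Set.mem_iUnion.1 (hcov1 Γ hω₂)
  exact closedSpan_thetaWedgeFns_mono (Θ := Θp a b) (h2 a b) (h3 a b) (hpair a b Γ ω₁ ω₂ (h0 a b Γ ha) (h1 a b Γ hb))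

/-- **Per-pair step + span step**: the (12) slots of `Θ` need only lie in the SPANS of the unions `⋃ₐ Θ₀ a Γ`, `⋃_b Θ₁ b Γ`
(exhaustion as stated in print: `U_Ψ(Γ) ⊆ span{theta one-forms}`). [folklore] -/
theorem of_pairFamilies_span {A B : Type*}
    (Θ₀ : A → ∀ Γ : Level V, Set (U.CohC (U.pms L ι₁ V Γ) 1))
    (Θ₁ : B → ∀ Γ : Level V, Set (U.CohC (U.pms L ι₁ V Γ) 1))
    (Θp : A → B → Fin 4 → ∀ Γ : Level V, Set (U.CohC (U.pms L ι₁ V Γ) 1))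
    (h0 : ∀ a b Γ, Θ₀ a Γ ⊆ Θp a b 0 Γ) (h1 : ∀ a b Γ, Θ₁ b Γ ⊆ Θp a b 1 Γ)
    (h2 : ∀ a b Γ, Θp a b 2 Γ ⊆ Θ 2 Γ) (h3 : ∀ a b Γ, Θp a b 3 Γ ⊆ Θ 3 Γ)
    (hE0 : ∀ Γ, Θ 0 Γ ⊆ (Submodule.span ℂ (⋃ a, Θ₀ a Γ) : Set (U.CohC (U.pms L ι₁ V Γ) 1)))
    (hE1 : ∀ Γ, Θ 1 Γ ⊆ (Submodule.span ℂ (⋃ b, Θ₁ b Γ) : Set (U.CohC (U.pms L ι₁ V Γ) 1)))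
    (hpair : ∀ a b, IsolationSpans U emb (Θp a b)) :
    IsolationSpans U emb Θ := by
  -- the UNION family: (12) slots = the unions, (34) slots = those of `Θ`
  let Θu : Fin 4 → ∀ Γ : Level V, Set (U.CohC (U.pms L ι₁ V Γ) 1) := fun i Γ =>
    if i = 0 then ⋃ a, Θ₀ a Γ else if i = 1 then ⋃ b, Θ₁ b Γ else Θ i Γ
  have hu : IsolationSpans U emb Θu :=
    of_pairFamilies (Θ := Θu) Θ₀ Θ₁ Θp h0 h1 (fun a b Γ => by simpa [Θu] using h2 a b Γ)
      (fun a b Γ => by simpa [Θu] using h3 a b Γ) (fun Γ => by simp [Θu]) (fun Γ => by simp [Θu]) hpair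
  exact of_span (Θ := Θu) hu (fun Γ => by simpa [Θu] using hE0 Γ) (fun Γ => by simpa [Θu] using hE1 Γ)
    (fun Γ => by simp [Θu]) (fun Γ => by simp [Θu])

/-- **Per-pair SETTINGS** (the residual (E2) made explicit, with PAIR-DEPENDENT carriers): for every pair `(a, b)` an isolation
setting `S a b` (its own `L²([U(W_ab)])`, torus sides, Schwartz space, sign indices — the types `H CG G SK SigIdx SigIdxG` all depend on
the pair; only the target `HG = L²([G_U])` is common) together with its two Lemma-3.5 memberships `hg`, `hr` for the pair family
`Θp a b`; then `IsolationSpans U emb Θ` by `ofSetting` pairwise and `of_pairFamilies_span`. [folklore] -/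
theorem of_pairSettings [CompleteSpace HG] {A B : Type*}
    {H CG G SK SigIdx SigIdxG : A → B → Type*}
    [∀ a b, NormedAddCommGroup (H a b)] [∀ a b, InnerProductSpace ℂ (H a b)] [∀ a b, CompleteSpace (H a b)]
    [∀ a b, NormedAddCommGroup (CG a b)] [∀ a b, NormedSpace ℂ (CG a b)]
    [∀ a b, Group (G a b)] [∀ a b, TopologicalSpace (G a b)] [∀ a b, TopologicalSpace (SK a b)]
    (Θ₀ : A → ∀ Γ : Level V, Set (U.CohC (U.pms L ι₁ V Γ) 1))
    (Θ₁ : B → ∀ Γ : Level V, Set (U.CohC (U.pms L ι₁ V Γ) 1))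
    (Θp : A → B → Fin 4 → ∀ Γ : Level V, Set (U.CohC (U.pms L ι₁ V Γ) 1))
    (h0 : ∀ a b Γ, Θ₀ a Γ ⊆ Θp a b 0 Γ) (h1 : ∀ a b Γ, Θ₁ b Γ ⊆ Θp a b 1 Γ)
    (h2 : ∀ a b Γ, Θp a b 2 Γ ⊆ Θ 2 Γ) (h3 : ∀ a b Γ, Θp a b 3 Γ ⊆ Θ 3 Γ)
    (hE0 : ∀ Γ, Θ 0 Γ ⊆ (Submodule.span ℂ (⋃ a, Θ₀ a Γ) : Set (U.CohC (U.pms L ι₁ V Γ) 1)))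
    (hE1 : ∀ Γ, Θ 1 Γ ⊆ (Submodule.span ℂ (⋃ b, Θ₁ b Γ) : Set (U.CohC (U.pms L ι₁ V Γ) 1)))
    (S : ∀ a b, Perl34.IsolationSetting (H a b) HG (CG a b) (G a b) (SK a b) (SigIdx a b) (SigIdxG a b))
    (hg : ∀ a b, Gen12 U emb (Θp a b) (Datum.ofSetting (S a b)))
    (hr : ∀ a b, ∀ χ : (S a b).t34.X, (S a b).t34.allowed χ → ∀ Φ : SK a b,
      (S a b).t34.ϑ χ Φ ∈ (Submodule.span ℂ (thetaWedgeFns U emb (Θp a b) 2 3)).topologicalClosure) :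
    IsolationSpans U emb Θ :=
  of_pairFamilies_span Θ₀ Θ₁ Θp h0 h1 h2 h3 hE0 hE1 (fun a b => ofSetting (S a b) (hg a b) (hr a b))

/-! ## §4  The saturated clause (α) of the END DISPLAY = `IsolationSpans` at the isotypic family; the reduction -/

/-- Clause (α) of binder `hD` of `Model.hc_cm_of_supply_of_dictionary_of_eq` (`Item6HoldsRec.lean`:211–219; equally the first
conjunct of `hD` in `Model.faceThetaDataExists_of_supply_of_dictionary` :157–165 and in `CorCM/B01/FaceWedgeOverlapDescent.lean` /
`FaceWedgeOverlapBypass.lean`), for a face `f` at `(ι₁, V, HG, emb)`, IS `IsolationSpans U emb (fun i Γ => ↑(U.Uiso Γ F (f.psi i) ι₁))`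
— definitionally. [folklore] -/
theorem uiso_iff {F : CMField} (f : Face F) {ι₁ : F →+* ℂ} {V : HermSpace3 F ι₁}
    (emb : ∀ Γ : Level V, U.CohC (U.pms F ι₁ V Γ) 2 →ₗ[ℂ] HG) :
    IsolationSpans U emb (fun i Γ => (U.Uiso Γ F (f.psi i) ι₁ : Set (U.CohC (U.pms F ι₁ V Γ) 1))) ↔
      (∀ (Γ : Level V) (ω₁ ω₂ : U.CohC (U.pms F ι₁ V Γ) 1), ω₁ ∈ U.Uiso Γ F (f.psi 0) ι₁ → ω₂ ∈ U.Uiso Γ F (f.psi 1) ι₁ →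
        emb Γ (U.cup2C (U.pms F ι₁ V Γ) 1 ω₁ ω₂) ∈ (Submodule.span ℂ
          {x : HG | ∃ (Γ' : Level V), ∃ ω₃ ∈ U.Uiso Γ' F (f.psi 2) ι₁, ∃ ω₄ ∈ U.Uiso Γ' F (f.psi 3) ι₁,
            x = emb Γ' (U.cup2C (U.pms F ι₁ V Γ') 1 ω₃ ω₄)}).topologicalClosure) :=
  Iff.rfl

/-- **THE REDUCTION: saturated (α) from per-pair settings + exhaustion + (34)-typing.**  For a face `f` at `(ι₁, V, HG, emb)`:
line families `Θ₀ a`, `Θ₁ b` EXHAUSTING `U_{ψ₀}(Γ)`, `U_{ψ₁}(Γ)` ((E1): `U.Uiso Γ F (f.psi i) ι₁ ≤ span (⋃ Θᵢ · Γ)`, `i = 0, 1` —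
Rogawski 1990 §13.3 / [GR91] §3 / [Liu 2021] Prop. 4.13, Rem. 4.14, CITE-LEVEL, not typed here), pair families `Θp a b` whose (34)
slots are `U_{ψ₂}`-, `U_{ψ₃}`-classes ((E3): `Theta_sub` of the pair's (34) theta one-forms), and per pair an isolation setting with its
Lemma-3.5 memberships ((E2): PerL §3 verbatim, per pair-plane; `IsolationSpans.ofSetting`) give `IsolationSpans` at the `Uiso` family,
i.e. clause (α) of `hD` by `uiso_iff`. [folklore] -/
theorem saturated_of_pairSettings [CompleteSpace HG] {F : CMField} (f : Face F) {ι₁ : F →+* ℂ} {V : HermSpace3 F ι₁}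
    {emb : ∀ Γ : Level V, U.CohC (U.pms F ι₁ V Γ) 2 →ₗ[ℂ] HG} {A B : Type*}
    {H CG G SK SigIdx SigIdxG : A → B → Type*}
    [∀ a b, NormedAddCommGroup (H a b)] [∀ a b, InnerProductSpace ℂ (H a b)] [∀ a b, CompleteSpace (H a b)]
    [∀ a b, NormedAddCommGroup (CG a b)] [∀ a b, NormedSpace ℂ (CG a b)]
    [∀ a b, Group (G a b)] [∀ a b, TopologicalSpace (G a b)] [∀ a b, TopologicalSpace (SK a b)]
    (Θ₀ : A → ∀ Γ : Level V, Set (U.CohC (U.pms F ι₁ V Γ) 1))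
    (Θ₁ : B → ∀ Γ : Level V, Set (U.CohC (U.pms F ι₁ V Γ) 1))
    (Θp : A → B → Fin 4 → ∀ Γ : Level V, Set (U.CohC (U.pms F ι₁ V Γ) 1))
    (h0 : ∀ a b Γ, Θ₀ a Γ ⊆ Θp a b 0 Γ) (h1 : ∀ a b Γ, Θ₁ b Γ ⊆ Θp a b 1 Γ)
    (hsub2 : ∀ a b Γ, Θp a b 2 Γ ⊆ U.Uiso Γ F (f.psi 2) ι₁) (hsub3 : ∀ a b Γ, Θp a b 3 Γ ⊆ U.Uiso Γ F (f.psi 3) ι₁)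
    (hE0 : ∀ Γ, U.Uiso Γ F (f.psi 0) ι₁ ≤ Submodule.span ℂ (⋃ a, Θ₀ a Γ))
    (hE1 : ∀ Γ, U.Uiso Γ F (f.psi 1) ι₁ ≤ Submodule.span ℂ (⋃ b, Θ₁ b Γ))
    (S : ∀ a b, Perl34.IsolationSetting (H a b) HG (CG a b) (G a b) (SK a b) (SigIdx a b) (SigIdxG a b))
    (hg : ∀ a b, Gen12 U emb (Θp a b) (Datum.ofSetting (S a b)))
    (hr : ∀ a b, ∀ χ : (S a b).t34.X, (S a b).t34.allowed χ → ∀ Φ : SK a b,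
      (S a b).t34.ϑ χ Φ ∈ (Submodule.span ℂ (thetaWedgeFns U emb (Θp a b) 2 3)).topologicalClosure) :
    IsolationSpans U emb (fun i Γ => (U.Uiso Γ F (f.psi i) ι₁ : Set (U.CohC (U.pms F ι₁ V Γ) 1))) :=
  of_pairSettings (Θ := fun i Γ => (U.Uiso Γ F (f.psi i) ι₁ : Set (U.CohC (U.pms F ι₁ V Γ) 1)))
    Θ₀ Θ₁ Θp h0 h1 hsub2 hsub3 (fun Γ => hE0 Γ) (fun Γ => hE1 Γ) S hg hr

/-- **The reduction in the literal clause shape of `hD`** (`Item6HoldsRec.lean`:211–219): same hypotheses, conclusion printed as the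
coupling clause (α) of the END DISPLAY, for direct substitution into `hD`'s first conjunct (the other two conjuncts, `emb_cover` and
`inner_emb`, are item (iii)'s dictionary and are untouched here). [folklore] -/
theorem coupling_uiso_of_pairSettings [CompleteSpace HG] {F : CMField} (f : Face F) {ι₁ : F →+* ℂ} {V : HermSpace3 F ι₁}
    {emb : ∀ Γ : Level V, U.CohC (U.pms F ι₁ V Γ) 2 →ₗ[ℂ] HG} {A B : Type*}
    {H CG G SK SigIdx SigIdxG : A → B → Type*}
    [∀ a b, NormedAddCommGroup (H a b)] [∀ a b, InnerProductSpace ℂ (H a b)] [∀ a b, CompleteSpace (H a b)]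
    [∀ a b, NormedAddCommGroup (CG a b)] [∀ a b, NormedSpace ℂ (CG a b)]
    [∀ a b, Group (G a b)] [∀ a b, TopologicalSpace (G a b)] [∀ a b, TopologicalSpace (SK a b)]
    (Θ₀ : A → ∀ Γ : Level V, Set (U.CohC (U.pms F ι₁ V Γ) 1))
    (Θ₁ : B → ∀ Γ : Level V, Set (U.CohC (U.pms F ι₁ V Γ) 1))
    (Θp : A → B → Fin 4 → ∀ Γ : Level V, Set (U.CohC (U.pms F ι₁ V Γ) 1))
    (h0 : ∀ a b Γ, Θ₀ a Γ ⊆ Θp a b 0 Γ) (h1 : ∀ a b Γ, Θ₁ b Γ ⊆ Θp a b 1 Γ)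
    (hsub2 : ∀ a b Γ, Θp a b 2 Γ ⊆ U.Uiso Γ F (f.psi 2) ι₁) (hsub3 : ∀ a b Γ, Θp a b 3 Γ ⊆ U.Uiso Γ F (f.psi 3) ι₁)
    (hE0 : ∀ Γ, U.Uiso Γ F (f.psi 0) ι₁ ≤ Submodule.span ℂ (⋃ a, Θ₀ a Γ))
    (hE1 : ∀ Γ, U.Uiso Γ F (f.psi 1) ι₁ ≤ Submodule.span ℂ (⋃ b, Θ₁ b Γ))
    (S : ∀ a b, Perl34.IsolationSetting (H a b) HG (CG a b) (G a b) (SK a b) (SigIdx a b) (SigIdxG a b))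
    (hg : ∀ a b, Gen12 U emb (Θp a b) (Datum.ofSetting (S a b)))
    (hr : ∀ a b, ∀ χ : (S a b).t34.X, (S a b).t34.allowed χ → ∀ Φ : SK a b,
      (S a b).t34.ϑ χ Φ ∈ (Submodule.span ℂ (thetaWedgeFns U emb (Θp a b) 2 3)).topologicalClosure) :
    ∀ (Γ : Level V) (ω₁ ω₂ : U.CohC (U.pms F ι₁ V Γ) 1), ω₁ ∈ U.Uiso Γ F (f.psi 0) ι₁ → ω₂ ∈ U.Uiso Γ F (f.psi 1) ι₁ →
      emb Γ (U.cup2C (U.pms F ι₁ V Γ) 1 ω₁ ω₂) ∈ (Submodule.span ℂ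
        {x : HG | ∃ (Γ' : Level V), ∃ ω₃ ∈ U.Uiso Γ' F (f.psi 2) ι₁, ∃ ω₄ ∈ U.Uiso Γ' F (f.psi 3) ι₁,
          x = emb Γ' (U.cup2C (U.pms F ι₁ V Γ') 1 ω₃ ω₄)}).topologicalClosure :=
  (uiso_iff f emb).1 (saturated_of_pairSettings f Θ₀ Θ₁ Θp h0 h1 hsub2 hsub3 hE0 hE1 S hg hr)

end IsolationSpans

end Transposition

end Summit.HodgeConjecture.CorCM

end
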